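import Summits.AtomisticToContinuum.BoseEinsteinCondensation.Theorems.BECConjugateDominationPuffFloorPuffFeynmanPrep
import Literature.MathematicalPhysics.QuantumManyBody.PuffCubicMomentOperator
import Literature.MathematicalPhysics.QuantumManyBody.PuffCubicMomentBlocks
import Literature.MathematicalPhysics.QuantumManyBody.PeriodicInteractionHessianPhaseSum
import Literature.MathematicalPhysics.QuantumManyBody.PeriodicFormCauchySchwarz

/-!
# Route `BECConjugateDomination`, crux `PuffFloor` (stmt-AtomisticToContinuum-11785),
# line `coupling-slope-pocket`, stub S4b: the Puff–Feynman floor `S_m ≥ |k|/√(|k|² + Θ)`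

Supports (does not close) stmt-AtomisticToContinuum-11785: the registered stub `stub_puffFeynmanFloor`
with Puff's numerics `c₁ = 12`, `c₂ = 2`. For a real, `C³`, exact minimiser `Ψ = u` of the periodic
`(n+1)`-body energy satisfying `-ΔΨ + V^perΨ = E₀Ψ` pointwise (`v` finite, `C²` as `ṽ(x) = v(|x|)`,
range `R₀ < L/2`), a mode `m ≠ 0`, `k = 2πm/L`, `κ = ‖k‖²`, `eⱼ = e^{ik·xⱼ}`, `ρ_k = ∑ⱼeⱼ`:

1. `A := ∑ⱼ eⱼ(κu - 2i∂ⱼu) = (H-E₀)(ρ_k u)` and `B := (H-E₀)A` pointwise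
   (`puff_first_commutator`, `puff_second_commutator`);
2. the shifted form `q(φ) = ∫(|∇φ|² + (V-E₀)|φ|²)` is non-negative on the Bose class (variational
   principle) with polar pairing `q(η, φ) = Re ∫ conj(η)(-Δφ + (V-E₀)φ)` (Green), so
   `q(ρ_k u) = Re⟨ρ_k u, A⟩ = m₁ = (n+1)κ` (f-sum rule), `q(A, ρ_k u) = ‖A‖² = m₂`,
   `q(A) = Re⟨A, B⟩ = Q`, and Cauchy–Schwarz twice: `m₁² ≤ m₀ m₂` (`m₀ = ‖ρ_k u‖² = (n+1)S_m`),
   `m₂² ≤ m₁ Q`, whence `m₁³ ≤ m₀² Q`;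
3. Puff's evaluation `Q = (n+1)κ³ + 12κ∫∑ⱼ(∂ⱼu)² + 2Re∫u²∑_{j,l}eⱼēₗ∂ₗ∂ⱼV` (`puff_cubic_moment_pairing`)
   and the bounds `∑ⱼ(∂ⱼu)² ≤ κ|∇u|²`, `Re∑_{j,l}eⱼēₗ∂ₗ∂ⱼV ≤ κ²∑_{a<b}W^per(x_a-x_b)`
   (`re_sum_phase_mul_hessian_le`, `W(r) = r²‖D²ṽ(re₀)‖`) give `Q ≤ (n+1)κ²(κ + Θ)` under
   `12T + 2P ≤ Θ(n+1)`;
4. algebra: `κ ≤ S_m²(κ + Θ)`.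

References: R. D. Puff, Phys. Rev. 137 (1965) A406; S. Stringari, in *Bose–Einstein Condensation*
(CUP 1995) §2.3 (20)–(23); R. P. Feynman, Phys. Rev. 94 (1954) 262.
-/

noncomputable section

namespace Summit.AtomisticToContinuum.BoseEinsteinCondensation.Theorems

open MeasureTheory Filter
open scoped ENNReal NNReal BigOperators ComplexConjugate
open Literature.MathematicalPhysics.QuantumManyBody.BoseGas
open Summit.AtomisticToContinuum.BoseEinsteinCondensation.Theses.BECConjugateDomination
open Summit.AtomisticToContinuum.BoseEinsteinCondensation.Cruxes.InfraredMinimumUncertainty.FisherGaussianDensityMode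

namespace PuffFeynmanFloor

/-- `|z|² = Re(conj(z) z)` (local helper). [folklore] -/
private theorem norm_sq_eq_re_conj_mul_self (z : ℂ) : ‖z‖ ^ 2 = (conj z * z).re := by
  rw [Complex.sq_norm, Complex.normSq_apply]
  simp only [Complex.mul_re, Complex.conj_re, Complex.conj_im]
  ring

/-- The shifted form at `φ` is its polar pairing at `(φ, φ)`. [folklore] -/
theorem form_self_eq_pairing {N : ℕ} (W : Config N → ℝ) (φ : Config N → ℂ) (X : Config N) :
    kineticDensityReal φ X + W X * ‖φ X‖ ^ 2 =
      (∑ i : Fin N, ∑ a : Fin 3, (conj (fderiv ℝ φ X (Pi.single i (EuclideanSpace.single a (1 : ℝ)))) *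
        fderiv ℝ φ X (Pi.single i (EuclideanSpace.single a (1 : ℝ)))).re) + W X * (conj (φ X) * φ X).re := by
  rw [kineticDensityReal, norm_sq_eq_re_conj_mul_self]
  congr 1
  exact Finset.sum_congr rfl fun i _ => Finset.sum_congr rfl fun a _ => norm_sq_eq_re_conj_mul_self _

/-- The final algebra: from `m₁ = Nκ`, `m₁² ≤ m₀m₂`, `m₂² ≤ m₁Q`, `Q ≤ Nκ²(κ+Θ)`, `m₀ = N S`:
`√κ/√(κ+Θ) ≤ S`. [folklore] -/
theorem floor_algebra {N κ Θ m₀ m₁ m₂ Q S : ℝ} (hN : 0 < N) (hκ : 0 < κ) (hΘ : 0 ≤ Θ)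
    (h1 : m₁ = N * κ) (h2 : m₁ ^ 2 ≤ m₀ * m₂) (h3 : m₂ ^ 2 ≤ m₁ * Q) (h4 : Q ≤ N * κ ^ 2 * (κ + Θ))
    (h0 : m₀ = N * S) (hS : 0 ≤ S) :
    Real.sqrt κ / Real.sqrt (κ + Θ) ≤ S := by
  have hm₁ : 0 < m₁ := by rw [h1]; positivity
  -- `m₁⁴ ≤ m₀² m₂² ≤ m₀² m₁ Q`, so `m₁³ ≤ m₀² Q`
  have h5 : m₁ ^ 4 ≤ m₀ ^ 2 * m₂ ^ 2 := by nlinarith [sq_nonneg m₁]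
  have hm₀ : 0 ≤ m₀ := by rw [h0]; positivity
  have h6 : m₁ ^ 4 ≤ m₀ ^ 2 * (m₁ * Q) := h5.trans (mul_le_mul_of_nonneg_left h3 (sq_nonneg _))
  have h7 : m₁ ^ 3 ≤ m₀ ^ 2 * Q := by
    have : m₁ * m₁ ^ 3 ≤ m₁ * (m₀ ^ 2 * Q) := by nlinarith
    exact le_of_mul_le_mul_left this hm₁
  have h8 : m₁ ^ 3 ≤ m₀ ^ 2 * (N * κ ^ 2 * (κ + Θ)) := h7.trans (mul_le_mul_of_nonneg_left h4 (sq_nonneg _))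
  rw [h1, h0] at h8
  -- `κ ≤ S² (κ + Θ)`
  have h9 : κ ≤ S ^ 2 * (κ + Θ) := by
    have hN3 : 0 < N ^ 3 * κ ^ 2 := by positivity
    have : N ^ 3 * κ ^ 2 * κ ≤ N ^ 3 * κ ^ 2 * (S ^ 2 * (κ + Θ)) := by nlinarith
    exact le_of_mul_le_mul_left this hN3
  have hκΘ : 0 < κ + Θ := by linarith
  rw [div_le_iff₀ (Real.sqrt_pos.2 hκΘ), ← Real.sqrt_sq hS, ← Real.sqrt_mul (sq_nonneg S)]
  exact Real.sqrt_le_sqrt h9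

/-- **The Puff–Feynman floor for given data** (the engine of `stub_puffFeynmanFloor`). -/
theorem floor_of_data (v : ℝ → ℝ≥0∞) (hv : IsRepulsiveFiniteRange v) (hfin : ∀ r, v r ≠ ⊤)
    (hC2 : ContDiff ℝ 2 (fun x : Space => (v ‖x‖).toReal)) (R₀ : ℝ)
    (hrange : ∀ r, R₀ < r → v r = 0) (n : ℕ) (L : ℝ) (hL : 0 < L) (h2R : 2 * R₀ < L)
    (Ψ : PeriodicTrialState (n + 1) L) (hC3 : ContDiff ℝ 3 Ψ.ψ)
    (hmin : periodicEnergy v Ψ = periodicGroundStateEnergy v (n + 1) L) (hfinE : periodicEnergy v Ψ ≠ ⊤)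
    (hreal : ∀ X, Ψ.ψ X = (‖Ψ.ψ X‖ : ℂ))
    (hEL : ∀ X : Config (n + 1),
      -(∑ i : Fin (n + 1), ∑ a : Fin 3,
          fderiv ℝ (fun Y : Config (n + 1) =>
              fderiv ℝ Ψ.ψ Y (Pi.single i (EuclideanSpace.single a (1 : ℝ)))) X
            (Pi.single i (EuclideanSpace.single a (1 : ℝ)))) +
        ((periodicInteraction v L X).toReal : ℂ) * Ψ.ψ X =
      ((periodicGroundStateEnergy v (n + 1) L).toReal : ℂ) * Ψ.ψ X)
    (Θ : ℝ) (hΘ : 0 ≤ Θ)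
    (hbound : ENNReal.ofReal 12 * (∫⁻ X in cellN (n + 1) L, kineticDensity Ψ.ψ X) +
        ENNReal.ofReal 2 * (∫⁻ X in cellN (n + 1) L,
          periodicInteraction (fun r : ℝ => ENNReal.ofReal (r ^ 2 *
            ‖iteratedFDeriv ℝ 2 (fun x : Space => (v ‖x‖).toReal)
              (r • EuclideanSpace.single (0 : Fin 3) (1 : ℝ))‖)) L X *
            (‖Ψ.ψ X‖₊ : ℝ≥0∞) ^ 2)
      ≤ ENNReal.ofReal (Θ * ((n : ℝ) + 1)))
    (m : Fin 3 → ℤ) (hm : m ≠ 0) :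
    ‖(2 * Real.pi / L) • latticeVec 1 m‖ /
        Real.sqrt (‖(2 * Real.pi / L) • latticeVec 1 m‖ ^ 2 + Θ)
      ≤ ((n : ℝ) + 1)⁻¹ *
          ∫ X in cellN (n + 1) L, ‖∑ j : Fin (n + 1), cellWave L m (X j)‖ ^ 2 * ‖Ψ.ψ X‖ ^ 2 := by
  -- ### data
  set k : Space := (2 * Real.pi / L) • latticeVec 1 m with hk
  have hkpos : 0 < ‖k‖ := norm_waveVec_pos hL hm
  set u : Config (n + 1) → ℝ := fun X => (Ψ.ψ X).re with hu
  set V : Config (n + 1) → ℝ := fun X => (periodicInteraction v L X).toReal with hV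
  set E₀ : ℝ := (periodicGroundStateEnergy v (n + 1) L).toReal with hE₀
  set W : Config (n + 1) → ℝ := fun X => V X - E₀ with hW
  have hu3 : ContDiff ℝ 3 u := contDiff_three_realAmp Ψ hC3
  have hu2 : ContDiff ℝ 2 u := hu3.of_le (by norm_num)
  have hu1 : ContDiff ℝ 1 u := hu3.of_le (by norm_num)
  have huper : IsLatticePeriodic L u := realAmp_periodic Ψ
  have hV2 : ContDiff ℝ 2 V := contDiff_toReal_periodicInteraction hrange h2R hL hfin hC2
  have hVper : IsLatticePeriodic L V := fun X i c => by simp only [hV, periodicInteraction_add_single]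
  have hWc : Continuous W := hV2.continuous.sub continuous_const
  have hEq : ∀ X : Config (n + 1), -(∑ i : Fin (n + 1), ∑ a : Fin 3,
      fderiv ℝ (fun Y => fderiv ℝ u Y (Pi.single i (EuclideanSpace.single a (1 : ℝ)))) X
        (Pi.single i (EuclideanSpace.single a (1 : ℝ)))) + V X * u X = E₀ * u X :=
    realEquation Ψ hreal hC3 hEL
  have hEfin : periodicGroundStateEnergy v (n + 1) L ≠ ⊤ := hmin ▸ hfinE
  -- the amplitudes
  set G : Config (n + 1) → ℂ := fun X => ∑ j : Fin (n + 1), cellWave L m (X j) with hG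
  set Gu : Config (n + 1) → ℂ := fun X => (∑ j : Fin (n + 1), cellWave L m (X j)) * ((u X : ℝ) : ℂ) with hGu
  set A : Config (n + 1) → ℂ := fun X => ∑ j : Fin (n + 1), cellWave L m (X j) *
    ((((‖k‖ ^ 2 : ℝ) : ℂ)) * ((u X : ℝ) : ℂ) - 2 * Complex.I * ((fderiv ℝ u X (Pi.single j k) : ℝ) : ℂ)) with hA
  set B : Config (n + 1) → ℂ := fun X => ∑ j : Fin (n + 1), cellWave L m (X j) *
    ((((‖k‖ ^ 2 : ℝ) : ℂ)) ^ 2 * ((u X : ℝ) : ℂ) -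
      4 * Complex.I * ((‖k‖ ^ 2 : ℝ) : ℂ) * ((fderiv ℝ u X (Pi.single j k) : ℝ) : ℂ) -
      4 * ((fderiv ℝ (fun Y => fderiv ℝ u Y (Pi.single j k)) X (Pi.single j k) : ℝ) : ℂ) +
      2 * Complex.I * ((fderiv ℝ V X (Pi.single j k) : ℝ) : ℂ) * ((u X : ℝ) : ℂ)) with hB
  have hGu3 : ContDiff ℝ 3 Gu := contDiff_rho_mul Ψ m hC3
  have hGu2 : ContDiff ℝ 2 Gu := hGu3.of_le (by norm_num)
  have hGu1 : ContDiff ℝ 1 Gu := hGu3.of_le (by norm_num)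
  have hGuper : ∀ (X : Config (n + 1)) (i : Fin (n + 1)) (c : Fin 3),
      Gu (X + Pi.single i (EuclideanSpace.single c L)) = Gu X := rho_mul_periodic hL Ψ m
  have hGusymm : ∀ (σ : Equiv.Perm (Fin (n + 1))) (X : Config (n + 1)), Gu (X ∘ σ) = Gu X :=
    rho_mul_symm Ψ m
  have hA2 : ContDiff ℝ 2 A := contDiff_commAmp Ψ m hC3 _ k
  have hA1 : ContDiff ℝ 1 A := hA2.of_le (by norm_num)
  have hAper : ∀ (X : Config (n + 1)) (i : Fin (n + 1)) (c : Fin 3),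
      A (X + Pi.single i (EuclideanSpace.single c L)) = A X := commAmp_periodic hL Ψ m _ k
  have hAsymm : ∀ (σ : Equiv.Perm (Fin (n + 1))) (X : Config (n + 1)), A (X ∘ σ) = A X :=
    commAmp_symm Ψ m _ k
  -- ### the four numbers
  set m₀ : ℝ := ∫ X in cellN (n + 1) L, ‖Gu X‖ ^ 2 with hm₀
  set m₁ : ℝ := (∫ X in cellN (n + 1) L, conj (Gu X) * A X).re with hm₁
  set m₂ : ℝ := ∫ X in cellN (n + 1) L, ‖A X‖ ^ 2 with hm₂
  set Q : ℝ := (∫ X in cellN (n + 1) L, conj (A X) * B X).re with hQ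
  -- (1) the f-sum rule
  have H1 : m₁ = ((n : ℝ) + 1) * ‖k‖ ^ 2 := fsum_real hL Ψ hreal m
  -- (2) the form pairings via Green and the commutators
  have hpairGu : ∀ (η : Config (n + 1) → ℂ), ContDiff ℝ 1 η →
      (∀ (X : Config (n + 1)) (i : Fin (n + 1)) (c : Fin 3), η (X + Pi.single i (EuclideanSpace.single c L)) = η X) →
      ∫ X in cellN (n + 1) L, ((∑ i : Fin (n + 1), ∑ a : Fin 3,
        (conj (fderiv ℝ η X (Pi.single i (EuclideanSpace.single a (1 : ℝ)))) *
          fderiv ℝ Gu X (Pi.single i (EuclideanSpace.single a (1 : ℝ)))).re) + W X * (conj (η X) * Gu X).re) =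
        (∫ X in cellN (n + 1) L, conj (η X) * A X).re := by
    intro η hη hηper
    rw [form_pairing_eq_re_integral hL hWc hη hGu2 hηper hGuper]
    congr 1
    refine integral_congr_ae (ae_of_all _ fun X => ?_)
    exact congrArg (fun z => conj (η X) * z) (puff_first_commutator m hk hu2 hEq X)
  have hpairA : ∀ (η : Config (n + 1) → ℂ), ContDiff ℝ 1 η →
      (∀ (X : Config (n + 1)) (i : Fin (n + 1)) (c : Fin 3), η (X + Pi.single i (EuclideanSpace.single c L)) = η X) →
      ∫ X in cellN (n + 1) L, ((∑ i : Fin (n + 1), ∑ a : Fin 3,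
        (conj (fderiv ℝ η X (Pi.single i (EuclideanSpace.single a (1 : ℝ)))) *
          fderiv ℝ A X (Pi.single i (EuclideanSpace.single a (1 : ℝ)))).re) + W X * (conj (η X) * A X).re) =
        (∫ X in cellN (n + 1) L, conj (η X) * B X).re := by
    intro η hη hηper
    rw [form_pairing_eq_re_integral hL hWc hη hA2 hηper hAper]
    congr 1
    refine integral_congr_ae (ae_of_all _ fun X => ?_)
    exact congrArg (fun z => conj (η X) * z) (puff_second_commutator m hk hu3 (hV2.of_le (by norm_num)) hEq X)
  -- the shifted form at `Gu` and at `A`, and the cross pairing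
  have hqGu : ∫ X in cellN (n + 1) L, (kineticDensityReal Gu X + W X * ‖Gu X‖ ^ 2) = m₁ := by
    simp_rw [form_self_eq_pairing W Gu]
    exact hpairGu Gu hGu1 hGuper
  have hqA : ∫ X in cellN (n + 1) L, (kineticDensityReal A X + W X * ‖A X‖ ^ 2) = Q := by
    simp_rw [form_self_eq_pairing W A]
    exact hpairA A hA1 hAper
  have hm₂eq : (∫ X in cellN (n + 1) L, conj (A X) * A X).re = m₂ := by
    have hint : Integrable (fun X => conj (A X) * A X) (volume.restrict (cellN (n + 1) L)) :=
      integrableOn_cellN ((Complex.continuous_conj.comp hA1.continuous).mul hA1.continuous) L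
    rw [← Complex.reCLM_apply (∫ X in cellN (n + 1) L, _), ← ContinuousLinearMap.integral_comp_comm _ hint]
    refine integral_congr_ae (ae_of_all _ fun X => ?_)
    simp only [Complex.reCLM_apply]
    exact (norm_sq_eq_re_conj_mul_self _).symm
  have hcross : ∫ X in cellN (n + 1) L, ((∑ i : Fin (n + 1), ∑ a : Fin 3,
      (conj (fderiv ℝ A X (Pi.single i (EuclideanSpace.single a (1 : ℝ)))) *
        fderiv ℝ Gu X (Pi.single i (EuclideanSpace.single a (1 : ℝ)))).re) + W X * (conj (A X) * Gu X).re) = m₂ := by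
    rw [hpairGu A hA1 hAper, hm₂eq]
  -- (3) Cauchy–Schwarz for the non-negative form: `m₂² ≤ m₁ Q`
  have hnonneg := shiftedForm_nonneg (n := n) hv hfin hC2.continuous hL hEfin hV2.continuous
  have H3 : m₂ ^ 2 ≤ m₁ * Q := by
    have h := sq_formPairing_le_of_nonneg hWc hnonneg hGu1 hA1 hGuper hAper hGusymm hAsymm
    rw [hcross, hqGu, hqA] at h
    exact h
  -- (4) Cauchy–Schwarz for the mass: `m₁² ≤ m₀ m₂`
  have H2 : m₁ ^ 2 ≤ m₀ * m₂ := by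
    have h := sq_integral_re_conj_mul_le hGu1.continuous hA1.continuous L
    have hre : (∫ X in cellN (n + 1) L, (conj (A X) * Gu X).re) = m₁ := by
      have hint : Integrable (fun X => conj (Gu X) * A X) (volume.restrict (cellN (n + 1) L)) :=
        integrableOn_cellN ((Complex.continuous_conj.comp hGu1.continuous).mul hA1.continuous) L
      rw [hm₁, ← Complex.reCLM_apply (∫ X in cellN (n + 1) L, _),
        ← ContinuousLinearMap.integral_comp_comm _ hint]
      refine integral_congr_ae (ae_of_all _ fun X => ?_)
      simp only [Complex.reCLM_apply]
      rw [← Complex.conj_re (conj (A X) * Gu X), map_mul, Complex.conj_conj, mul_comm]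
    rw [hre] at h
    exact h
  -- (5) Puff's evaluation of `Q` and its bound
  set Wp : ℝ → ℝ≥0∞ := fun r : ℝ => ENNReal.ofReal (r ^ 2 *
    ‖iteratedFDeriv ℝ 2 (fun x : Space => (v ‖x‖).toReal) (r • EuclideanSpace.single (0 : Fin 3) (1 : ℝ))‖) with hWp
  set Tr : ℝ := ∫ X in cellN (n + 1) L, kineticDensityReal Ψ.ψ X with hTr
  set Pl : ℝ≥0∞ := ∫⁻ X in cellN (n + 1) L, periodicInteraction Wp L X * ((‖Ψ.ψ X‖₊ : ℝ≥0∞)) ^ 2 with hPl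
  have hTfin : (∫⁻ X in cellN (n + 1) L, kineticDensity Ψ.ψ X) ≠ ⊤ :=
    ne_top_of_le_ne_top hfinE (lintegral_mono fun X => le_self_add)
  obtain ⟨hPfin, hTP⟩ := puffParameter_real Ψ hΘ hTfin hbound
  have hWm : Measurable Wp := measurable_puffWeight hC2
  have hWR : ∀ r, R₀ < r → Wp r = 0 := fun r hr => puffWeight_eq_zero_of_lt hrange hr
  have hWfin : ∀ X : Config (n + 1), periodicInteraction Wp L X ≠ ⊤ := fun X =>
    periodicInteraction_ne_top_of_range hWR h2R hL (fun r => ENNReal.ofReal_ne_top) X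
  obtain ⟨hPint, hPeq⟩ := pairFunctional_real Ψ hreal hWm hWfin hPfin
  have hQeval := puff_cubic_moment_pairing m hL hk hu2 hV2 huper hVper
  have hu_sq : ∫ X in cellN (n + 1) L, u X ^ 2 = 1 := integral_realAmp_sq Ψ hreal
  -- the kinetic term
  have hkin : ∫ X in cellN (n + 1) L, ∑ j : Fin (n + 1), fderiv ℝ u X (Pi.single j k) ^ 2 ≤ ‖k‖ ^ 2 * Tr := by
    rw [hTr, ← integral_const_mul]
    refine integral_mono ?_ ?_ fun X => sum_sq_fderiv_single_le Ψ hreal X k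
    · refine integrableOn_cellN (continuous_finsetSum _ fun j _ => ?_) L
      exact (continuous_fderiv_apply_const hu1 _).pow 2
    · exact integrableOn_cellN (continuous_const.mul (continuous_kineticDensityReal Ψ.contDiff)) L
  -- the potential term
  have hpot : (∫ X in cellN (n + 1) L, ((u X ^ 2 : ℝ) : ℂ) * ∑ j : Fin (n + 1), ∑ l : Fin (n + 1),
      cellWave L m (X j) * conj (cellWave L m (X l)) *
        ((fderiv ℝ (fun Y => fderiv ℝ V Y (Pi.single j k)) X (Pi.single l k) : ℝ) : ℂ)).re ≤
      ‖k‖ ^ 4 * Pl.toReal := by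
    have hce : ∀ j : Fin (n + 1), Continuous fun X : Config (n + 1) => cellWave L m (X j) := fun j =>
      (contDiff_cellWave L m).continuous.comp (continuous_apply j)
    have hc4 : ∀ j l : Fin (n + 1), Continuous fun X => fderiv ℝ (fun Y => fderiv ℝ V Y (Pi.single j k)) X
        (Pi.single l k) := fun j l => continuous_fderiv_apply_const (contDiff_one_fderiv_apply_const hV2 _) _
    have hfc : Continuous fun X => ((u X ^ 2 : ℝ) : ℂ) * ∑ j : Fin (n + 1), ∑ l : Fin (n + 1),
        cellWave L m (X j) * conj (cellWave L m (X l)) *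
          ((fderiv ℝ (fun Y => fderiv ℝ V Y (Pi.single j k)) X (Pi.single l k) : ℝ) : ℂ) := by
      refine (Complex.continuous_ofReal.comp (hu1.continuous.pow 2)).mul
        (continuous_finsetSum _ fun j _ => continuous_finsetSum _ fun l _ => ?_)
      have h1 := hce j; have h2 := hce l; have h3 := hc4 j l
      fun_prop
    have hint : Integrable (fun X => ((u X ^ 2 : ℝ) : ℂ) * ∑ j : Fin (n + 1), ∑ l : Fin (n + 1),
        cellWave L m (X j) * conj (cellWave L m (X l)) *
          ((fderiv ℝ (fun Y => fderiv ℝ V Y (Pi.single j k)) X (Pi.single l k) : ℝ) : ℂ))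
        (volume.restrict (cellN (n + 1) L)) := integrableOn_cellN hfc L
    have h1 := (Complex.reCLM.integral_comp_comm hint).symm
    simp only [Complex.reCLM_apply] at h1
    rw [h1, ← hPeq, ← integral_const_mul]
    refine integral_mono (integrableOn_cellN (Complex.continuous_re.comp hfc) L) (hPint.const_mul _) fun X => ?_
    have hb := re_sum_phase_mul_hessian_le (N := n + 1) hrange h2R hL hfin hC2 m X
    simp only [Complex.re_ofReal_mul]
    have hu0 : 0 ≤ u X ^ 2 := sq_nonneg _
    calc u X ^ 2 * (∑ j : Fin (n + 1), ∑ l : Fin (n + 1), cellWave L m (X j) * conj (cellWave L m (X l)) *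
          ((fderiv ℝ (fun Y => fderiv ℝ V Y (Pi.single j k)) X (Pi.single l k) : ℝ) : ℂ)).re
        ≤ u X ^ 2 * (‖k‖ ^ 4 * (periodicInteraction Wp L X).toReal) := mul_le_mul_of_nonneg_left hb hu0
      _ = ‖k‖ ^ 4 * ((periodicInteraction Wp L X).toReal * (Ψ.ψ X).re ^ 2) := by simp only [hu]; ring
  have H4 : Q ≤ ((n : ℝ) + 1) * (‖k‖ ^ 2) ^ 2 * (‖k‖ ^ 2 + Θ) := by
    rw [hQ, hQeval, hu_sq, Nat.cast_add_one]
    have hk4 : 0 ≤ ‖k‖ ^ 4 := by positivity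
    have hk2 : 0 ≤ ‖k‖ ^ 2 := by positivity
    have h1 := mul_le_mul_of_nonneg_left hkin hk2
    have h2 := mul_le_mul_of_nonneg_left hTP hk4
    have h3 := mul_le_mul_of_nonneg_left hpot (by norm_num : (0 : ℝ) ≤ 2)
    nlinarith [h1, h2, h3]
  -- (6) the algebra
  have hm₀S : m₀ = ((n : ℝ) + 1) * (((n : ℝ) + 1)⁻¹ *
      ∫ X in cellN (n + 1) L, ‖∑ j : Fin (n + 1), cellWave L m (X j)‖ ^ 2 * ‖Ψ.ψ X‖ ^ 2) := by
    rw [← mul_assoc, mul_inv_cancel₀ (by positivity : ((n : ℝ) + 1) ≠ 0), one_mul, hm₀]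
    exact integral_norm_sq_rho_mul Ψ m hreal
  have hS0 : 0 ≤ ((n : ℝ) + 1)⁻¹ *
      ∫ X in cellN (n + 1) L, ‖∑ j : Fin (n + 1), cellWave L m (X j)‖ ^ 2 * ‖Ψ.ψ X‖ ^ 2 :=
    mul_nonneg (by positivity) (integral_nonneg fun X => by positivity)
  have hfl := floor_algebra (by positivity : (0 : ℝ) < (n : ℝ) + 1) (by positivity : 0 < ‖k‖ ^ 2) hΘ H1 H2 H3
    H4 hm₀S hS0
  rwa [Real.sqrt_sq (norm_nonneg k)] at hfl

end PuffFeynmanFloor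

/-- **S4b `stub_puffFeynmanFloor`** (registered stub of crux stmt-AtomisticToContinuum-11785, line
`coupling-slope-pocket`): the Puff–Feynman sum-rule floor in sharp real form with Puff's numerics
`c₁ = 12`, `c₂ = 2`. For a finite `C²` finite-range profile (`2R₀ < L`) and a real, nowhere-zero,
`C³` exact minimiser `Ψ` of the periodic `(n+1)`-body energy satisfying the eigenvalue equation
pointwise, Puff's parameter bound `12·T + 2·P ≤ Θ(n+1)` (`T = ∫|∇Ψ|²`, `P = ∫∑_{i<j}W^per(xᵢ-xⱼ)|Ψ|²`,
`W(r) = r²‖D²ṽ(re₀)‖`) implies `S_m ≥ |k|/√(|k|² + Θ)` for every mode `m ≠ 0`, `k = 2πm/L`,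
`S_m = (n+1)⁻¹∫|∑ⱼe_m(xⱼ)|²|Ψ|²`. Proof: `PuffFeynmanFloor.floor_of_data` (f-sum rule, Puff's cubic
moment, two Cauchy–Schwarz steps, variational principle). Sources: Puff 1965; Stringari 1995 §2.3
(20)–(23); Feynman 1954. -/
theorem stub_puffFeynmanFloor :
    ∃ c₁ c₂ : ℝ, 0 ≤ c₁ ∧ 0 ≤ c₂ ∧
    ∀ v : ℝ → ℝ≥0∞, IsRepulsiveFiniteRange v → (∀ r, v r ≠ ⊤) →
      ContDiff ℝ 2 (fun x : Space => (v ‖x‖).toReal) →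
      ∀ R₀ : ℝ, 0 < R₀ → (∀ r, R₀ < r → v r = 0) →
      ∀ n : ℕ, ∀ L : ℝ, 0 < L → 2 * R₀ < L → ∀ Ψ : PeriodicTrialState (n + 1) L, ContDiff ℝ 3 Ψ.ψ →
        periodicEnergy v Ψ = periodicGroundStateEnergy v (n + 1) L → periodicEnergy v Ψ ≠ ⊤ →
        (∀ X, Ψ.ψ X = (‖Ψ.ψ X‖ : ℂ)) → (∀ X, Ψ.ψ X ≠ 0) →
        (∀ X : Config (n + 1),
          -(∑ i : Fin (n + 1), ∑ a : Fin 3,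
              fderiv ℝ (fun Y : Config (n + 1) =>
                  fderiv ℝ Ψ.ψ Y (Pi.single i (EuclideanSpace.single a (1 : ℝ)))) X
                (Pi.single i (EuclideanSpace.single a (1 : ℝ)))) +
            ((periodicInteraction v L X).toReal : ℂ) * Ψ.ψ X =
          ((periodicGroundStateEnergy v (n + 1) L).toReal : ℂ) * Ψ.ψ X) →
        ∀ Θ : ℝ, 0 ≤ Θ →
          ENNReal.ofReal c₁ * (∫⁻ X in cellN (n + 1) L, kineticDensity Ψ.ψ X) +
              ENNReal.ofReal c₂ * (∫⁻ X in cellN (n + 1) L,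
                periodicInteraction (fun r : ℝ => ENNReal.ofReal (r ^ 2 *
                  ‖iteratedFDeriv ℝ 2 (fun x : Space => (v ‖x‖).toReal)
                    (r • EuclideanSpace.single (0 : Fin 3) (1 : ℝ))‖)) L X *
                  (‖Ψ.ψ X‖₊ : ℝ≥0∞) ^ 2)
            ≤ ENNReal.ofReal (Θ * ((n : ℝ) + 1)) →
          ∀ m : Fin 3 → ℤ, m ≠ 0 →
            ‖(2 * Real.pi / L) • latticeVec 1 m‖ /
                Real.sqrt (‖(2 * Real.pi / L) • latticeVec 1 m‖ ^ 2 + Θ)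
              ≤ ((n : ℝ) + 1)⁻¹ *
                  ∫ X in cellN (n + 1) L, ‖∑ j : Fin (n + 1), cellWave L m (X j)‖ ^ 2 * ‖Ψ.ψ X‖ ^ 2 :=
  ⟨12, 2, by norm_num, by norm_num, fun v hv hfin hC2 R₀ _ hrange n L hL h2R Ψ hC3 hmin hfinE hreal _ hEL Θ hΘ
    hbound m hm => PuffFeynmanFloor.floor_of_data v hv hfin hC2 R₀ hrange n L hL h2R Ψ hC3 hmin hfinE hreal hEL
      Θ hΘ hbound m hm⟩

end Summit.AtomisticToContinuum.BoseEinsteinCondensation.Theorems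

end
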